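import Summits.CriticalPhenomena.PercolationContinuityZ3.Theorems.PercTorusSliceFillingSliceFillingTransport
import Summits.CriticalPhenomena.PercolationContinuityZ3.Theorems.PercTorusSliceFillingNoCriticalTorusGiantNonSfGiantMarkov
import Literature.Probability.Percolation.MeanFieldBetaFromGamma
import Literature.Probability.Percolation.KozmaNitzanBoxes

/-!
# Route `PercTorusSliceFilling`, crux `NoCriticalTorusGiant` — NECESSITY (support file)

Support file for item `stmt-CriticalPhenomena-5407` (crux `NoCriticalTorusGiant` of route
`CriticalPhenomena/PercTorusSliceFilling`): the crux FOLLOWS from the summit conjunct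
`θ(p_c) = 0` on `ℤ³`, i.e. it is NECESSARY for it.

* `real_clusterSize_torus_le_zd` — the static finite-range stochastic domination
  (Benjamini–Schramm 1996, Thm. 1 / Heydenreich–van der Hofstad 2017, Prop. 13.7): for
  Bernoulli bond percolation at ANY edge density `p`, every `n ≥ 2m + 2` and every vertex `x` of
  the discrete torus `T_n = (ℤ/nℤ)³` (`torusGraph 3 n`),

    `P_{T_n,p}(|C(x)| ≥ m + 1) ≤ P_{ℤ³,p}(|C(0)| ≥ m + 1)`.

  Proof: the chart `a ↦ x + proj a` of the box `B(m) = [-m, m]³` (chart file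
  `PercTorusSliceFillingSliceFillingTransportChart.lean`) is a graph isomorphism onto its image for
  `2m + 2 ≤ n`, and the configuration lifted along it has the law of a `ℤ³` configuration
  restricted to the box (`map_restrictConfig_chart_eq`). POINTWISE (only torus edges open, an
  almost sure event): if `|C(x)| ≥ m + 1` then the local cluster `Cloc` of `0` in the lifted
  configuration has at least `m + 1` vertices — either `Cloc` reaches the inner boundary of
  `B(m)`, and then an open self-avoiding path from `0` to `∂^{in}B(m)` inside `B(m)` already has
  `≥ m + 1` vertices (`Necessity.succ_le_ncard_of_arm`), or it does not, and then the chart image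
  of `Cloc` is closed under open torus edges (`exists_lift_of_adj`), hence contains `C(x)`
  (`Necessity.succ_le_ncard_locCluster`). On the `ℤ³` side the local cluster of the restricted
  configuration embeds into `C(0)` (`reachable_map_of_restrictConfig`).
* `noCriticalTorusGiant_of_theta_eq_zero` — **necessity**: `θ(p_c) = 0 ⇒ NoCriticalTorusGiant`.
  With `k = ⌈ε n³⌉ ≥ m + 1`, the first-moment Markov inequality over the `n³` vertices
  (`S1b.natCast_mul_measureReal_le_sum`) and the domination give
  `P_{T_n,p_c}(∃ x, |C(x)| ≥ ε n³) ≤ n³ P_{ℤ³,p_c}(|C(0)| ≥ m + 1) / k ≤ ε⁻¹ P_{ℤ³,p_c}(|C(0)| ≥ m + 1)`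
  for all large `n`, and `P_{ℤ³,p_c}(|C(0)| ≥ m + 1) ↓ θ(p_c) = 0` (`tendsto_real_clusterSizeGe`).

References: I. Benjamini, O. Schramm, *Percolation beyond `ℤ^d`, many questions and a few
answers*, Electron. Comm. Probab. 1 (1996), Thm. 1; M. Heydenreich, R. van der Hofstad,
*Progress in High-Dimensional Percolation and Random Graphs* (2017), Prop. 13.7; G. Grimmett,
*Percolation* (1999), §1.4.
-/

noncomputable section

namespace Summit.CriticalPhenomena.PercolationContinuityZ3.Theorems.PercTorusSliceFillingNoCriticalTorusGiant

open MeasureTheory ProbabilityTheory Filter Topology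
open Literature.Probability.Percolation Literature.Probability.LatticeModels
open Summit.CriticalPhenomena.PercolationContinuityZ3.Theorems.SliceFillingTransportProof
open scoped Classical

namespace Necessity

variable {n m : ℕ}

/-! ## Geometry of open paths in the lifted configuration

Lattice neighbours differ by at most `1` in every coordinate: `KozmaNitzan.abs_sub_le_one_of_adj`
(`KozmaNitzanBoxes.lean`). -/

/-- If only torus edges are open, an open edge of the configuration lifted along the chart
`a ↦ x + proj a` joins `ℤ³`-neighbours of the box (`chart_adj_iff`). -/
theorem adj_zd_of_adj_lift (hn : 2 * m + 2 ≤ n) (x : TorusSite 3 n)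
    {ω : BondConfig (TorusSite 3 n)} (hω : ω ⊆ (torusGraph 3 n).edgeSet)
    {a b : (box 3 m : Set (Site 3))}
    (h : (openGraph (restrictConfig
      (fun a : (box 3 m : Set (Site 3)) => x + Torus.proj n (a : Site 3)) ω)).Adj a b) :
    (zdGraph 3).Adj (a : Site 3) b := by
  rw [openGraph_adj, mem_restrictConfig, Sym2.map_mk] at h
  exact (chart_adj_iff hn x a b).1 ((SimpleGraph.mem_edgeSet _).1 (hω h.1))

/-- Along an open walk of the lifted configuration every coordinate moves by at most the length
of the walk. -/
theorem abs_sub_le_length (hn : 2 * m + 2 ≤ n) (x : TorusSite 3 n)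
    {ω : BondConfig (TorusSite 3 n)} (hω : ω ⊆ (torusGraph 3 n).edgeSet)
    {a b : (box 3 m : Set (Site 3))}
    (w : (openGraph (restrictConfig
      (fun a : (box 3 m : Set (Site 3)) => x + Torus.proj n (a : Site 3)) ω)).Walk a b)
    (i : Fin 3) : |(b : Site 3) i - (a : Site 3) i| ≤ w.length := by
  induction w with
  | nil => simp
  | @cons u v c hadj w ih =>
    have h1 := KozmaNitzan.abs_sub_le_one_of_adj (adj_zd_of_adj_lift hn x hω hadj) i
    rw [SimpleGraph.Walk.length_cons, Nat.cast_add, Nat.cast_one]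
    calc |(c : Site 3) i - (u : Site 3) i|
        ≤ |(c : Site 3) i - (v : Site 3) i| + |(v : Site 3) i - (u : Site 3) i| := abs_sub_le _ _ _
      _ ≤ w.length + 1 := add_le_add ih h1

/-- **Local arm ⇒ large local cluster.** If only torus edges are open and the local cluster of
`0` in the lifted configuration reaches an inner-boundary vertex `a` of `B(m)`, then it has at
least `m + 1` vertices: some coordinate of `a` is `± m`, so an open self-avoiding path from `0`
to `a` inside `B(m)` has length `≥ m`, i.e. `≥ m + 1` (distinct) vertices, all joined to `0`. -/
theorem succ_le_ncard_of_arm (hn : 2 * m + 2 ≤ n) (x : TorusSite 3 n)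
    {ω : BondConfig (TorusSite 3 n)} (hω : ω ⊆ (torusGraph 3 n).edgeSet)
    {a : (box 3 m : Set (Site 3))} (ha : (a : Site 3) ∈ innerBoundary (zdGraph 3) (box 3 m))
    (hr : (openGraph (restrictConfig
      (fun a : (box 3 m : Set (Site 3)) => x + Torus.proj n (a : Site 3)) ω)).Reachable
        ⟨0, zero_mem_boxSet m⟩ a) :
    m + 1 ≤ Set.ncard {b : (box 3 m : Set (Site 3)) | (openGraph (restrictConfig
      (fun a : (box 3 m : Set (Site 3)) => x + Torus.proj n (a : Site 3)) ω)).Reachable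
        ⟨0, zero_mem_boxSet m⟩ b} := by
  -- some coordinate of `a` has absolute value `≥ m`
  obtain ⟨i, hi⟩ : ∃ i : Fin 3, (m : ℤ) ≤ |(a : Site 3) i| := by
    rw [mem_innerBoundary_iff] at ha
    obtain ⟨-, z, hz, hadj⟩ := ha
    have hz' : ∃ i, ¬ (-(m : ℤ) ≤ z i ∧ z i ≤ m) := by
      by_contra h
      push Not at h
      exact hz (mem_box.2 h)
    obtain ⟨i, hzi⟩ := hz'
    refine ⟨i, ?_⟩
    have h1 := KozmaNitzan.abs_sub_le_one_of_adj hadj i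
    rw [abs_le] at h1
    rw [le_abs]
    omega
  -- an open self-avoiding path from `0` to `a` inside the box
  obtain ⟨w⟩ := hr
  have hp : w.bypass.IsPath := w.bypass_isPath
  have hlen : (m : ℤ) ≤ w.bypass.length := by
    have h := abs_sub_le_length hn x hω w.bypass i
    simp only [Pi.zero_apply, sub_zero] at h
    exact hi.trans h
  -- its support consists of `≥ m + 1` distinct vertices of the local cluster
  have hsupp : (↑w.bypass.support.toFinset : Set (box 3 m : Set (Site 3))) ⊆
      {b : (box 3 m : Set (Site 3)) | (openGraph (restrictConfig
        (fun a : (box 3 m : Set (Site 3)) => x + Torus.proj n (a : Site 3)) ω)).Reachable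
          ⟨0, zero_mem_boxSet m⟩ b} := by
    intro v hv
    rw [Finset.mem_coe, List.mem_toFinset] at hv
    exact ⟨w.bypass.takeUntil v hv⟩
  calc m + 1 ≤ w.bypass.length + 1 := by omega
    _ = w.bypass.support.length := w.bypass.length_support.symm
    _ = w.bypass.support.toFinset.card := (List.toFinset_card_of_nodup hp.support_nodup).symm
    _ = (↑w.bypass.support.toFinset : Set (box 3 m : Set (Site 3))).ncard :=
        (Set.ncard_coe_finset _).symm
    _ ≤ _ := Set.ncard_le_ncard hsupp (Set.toFinite _)

/-- **Pointwise key lemma** (only torus edges open): if `|C(x)| ≥ m + 1` then the local cluster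
of `0` in the configuration lifted along the chart has at least `m + 1` vertices. Either the
local cluster has an arm to `∂^{in}B(m)` (`succ_le_ncard_of_arm`), or its chart image is closed
under open torus edges (`exists_lift_of_adj`) and therefore contains `C(x)`. -/
theorem succ_le_ncard_locCluster (hn : 2 * m + 2 ≤ n) (x : TorusSite 3 n)
    {ω : BondConfig (TorusSite 3 n)} (hω : ω ⊆ (torusGraph 3 n).edgeSet)
    (hk : m + 1 ≤ (openCluster ω x).ncard) :
    m + 1 ≤ Set.ncard {b : (box 3 m : Set (Site 3)) | (openGraph (restrictConfig
      (fun a : (box 3 m : Set (Site 3)) => x + Torus.proj n (a : Site 3)) ω)).Reachable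
        ⟨0, zero_mem_boxSet m⟩ b} := by
  by_cases harm : ∃ a : (box 3 m : Set (Site 3)),
      (a : Site 3) ∈ innerBoundary (zdGraph 3) (box 3 m) ∧ (openGraph (restrictConfig
        (fun a : (box 3 m : Set (Site 3)) => x + Torus.proj n (a : Site 3)) ω)).Reachable
          ⟨0, zero_mem_boxSet m⟩ a
  · obtain ⟨a, ha, hr⟩ := harm
    exact succ_le_ncard_of_arm hn x hω ha hr
  · push Not at harm
    set η := restrictConfig (fun a : (box 3 m : Set (Site 3)) => x + Torus.proj n (a : Site 3)) ω
      with hη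
    -- the chart image of the local cluster of `0` contains `C(x)`
    have hsub : openCluster ω x ⊆
        (fun a : (box 3 m : Set (Site 3)) => x + Torus.proj n (a : Site 3)) ''
          {a | (openGraph η).Reachable ⟨0, zero_mem_boxSet m⟩ a} := by
      intro v hv
      change (openGraph ω).Reachable x v at hv
      rw [SimpleGraph.reachable_iff_reflTransGen] at hv
      induction hv with
      | refl =>
        refine ⟨⟨0, zero_mem_boxSet m⟩, SimpleGraph.Reachable.refl _, ?_⟩
        have h0' : Torus.proj n (0 : Site 3) = 0 := by ext i; simp [Torus.proj_apply]
        simp only [h0', add_zero]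
      | tail _ hbc ih =>
        obtain ⟨a, ha, rfl⟩ := ih
        have hain : (a : Site 3) ∉ innerBoundary (zdGraph 3) (box 3 m) := fun hin => harm a hin ha
        obtain ⟨b, hb, hab⟩ := exists_lift_of_adj x hω hain hbc
        exact ⟨b, SimpleGraph.Reachable.trans ha hab.reachable, hb⟩
    have hfin : {a : (box 3 m : Set (Site 3)) |
        (openGraph η).Reachable ⟨0, zero_mem_boxSet m⟩ a}.Finite := Set.toFinite _
    calc m + 1 ≤ (openCluster ω x).ncard := hk
      _ ≤ Set.ncard ((fun a : (box 3 m : Set (Site 3)) => x + Torus.proj n (a : Site 3)) ''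
            {a | (openGraph η).Reachable ⟨0, zero_mem_boxSet m⟩ a}) :=
          Set.ncard_le_ncard hsub (hfin.image _)
      _ ≤ _ := Set.ncard_image_le hfin

/-- **`ℤ³` side.** If the local cluster of `0` in a `ℤ³` configuration restricted to the box has
at least `m + 1` vertices, then `|C(0)| ≥ m + 1` (`Set.encard`; the restricted cluster embeds into
`C(0)`, `reachable_map_of_restrictConfig`). -/
theorem mem_clusterSizeGe_of_succ_le_ncard {ω : BondConfig (Site 3)}
    (h : m + 1 ≤ Set.ncard {b : (box 3 m : Set (Site 3)) | (openGraph (restrictConfig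
      (Subtype.val : (box 3 m : Set (Site 3)) → Site 3) ω)).Reachable ⟨0, zero_mem_boxSet m⟩ b}) :
    ω ∈ clusterSizeGe (0 : Site 3) (m + 1) := by
  rw [mem_clusterSizeGe]
  set C := {b : (box 3 m : Set (Site 3)) | (openGraph (restrictConfig
      (Subtype.val : (box 3 m : Set (Site 3)) → Site 3) ω)).Reachable ⟨0, zero_mem_boxSet m⟩ b}
    with hC
  have hfin : C.Finite := Set.toFinite C
  have himg : Subtype.val '' C ⊆ openCluster ω 0 := by
    rintro _ ⟨a, ha, rfl⟩
    exact reachable_map_of_restrictConfig Subtype.val_injective ω ha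
  calc ((m + 1 : ℕ) : ℕ∞) ≤ (C.ncard : ℕ∞) := Nat.cast_le.2 h
    _ = C.encard := hfin.cast_ncard_eq
    _ = (Subtype.val '' C).encard := (Subtype.val_injective.encard_image C).symm
    _ ≤ (openCluster ω 0).encard := Set.encard_le_encard himg

end Necessity

/-- **Finite-range stochastic domination** (Benjamini–Schramm 1996, Thm. 1 / Heydenreich–van der
Hofstad 2017, Prop. 13.7, static finite-range form). For every edge density `p`, every `n, m` with
`2m + 2 ≤ n` and every vertex `x` of the discrete torus `T_n = (ℤ/nℤ)³`,
`P_{T_n,p}(|C(x)| ≥ m + 1) ≤ P_{ℤ³,p}(|C(0)| ≥ m + 1)`: below the wrapping scale the torus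
cluster is stochastically dominated by the `ℤ³` cluster (same local law of the box chart,
`map_restrictConfig_chart_eq`, and the pointwise lemma `Necessity.succ_le_ncard_locCluster`). -/
theorem real_clusterSize_torus_le_zd (p : unitInterval) {n m : ℕ} (hn : 2 * m + 2 ≤ n)
    (x : TorusSite 3 n) :
    (bondPercolation (torusGraph 3 n) p).real {ω | m + 1 ≤ (openCluster ω x).ncard} ≤
      (bondPercolation (zdGraph 3) p).real (clusterSizeGe (0 : Site 3) (m + 1)) := by
  haveI : NeZero n := ⟨by omega⟩
  set μT := bondPercolation (torusGraph 3 n) p with hμT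
  set μZ := bondPercolation (zdGraph 3) p with hμZ
  set B : Set (BondConfig (box 3 m : Set (Site 3))) := {η | m + 1 ≤ Set.ncard
    {b : (box 3 m : Set (Site 3)) | (openGraph η).Reachable ⟨0, zero_mem_boxSet m⟩ b}} with hB
  -- almost surely only torus edges are open
  have hnullT : μT.real {ω : BondConfig (TorusSite 3 n) | ¬ ω ⊆ (torusGraph 3 n).edgeSet} = 0 := by
    have h := setBernoulli_ae_subset (u := (torusGraph 3 n).edgeSet) (p := p)
    rw [measureReal_eq_zero_iff]
    exact ae_iff.1 h
  -- pointwise: the lifted configuration has a large local cluster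
  have hcover : {ω : BondConfig (TorusSite 3 n) | m + 1 ≤ (openCluster ω x).ncard} ∩
      {ω | ω ⊆ (torusGraph 3 n).edgeSet} ⊆
        restrictConfig (fun a : (box 3 m : Set (Site 3)) => x + Torus.proj n (a : Site 3)) ⁻¹' B :=
    fun ω hω => Necessity.succ_le_ncard_locCluster hn x hω.2 hω.1
  -- transfer: same local law
  have htransfer :
      μT.real (restrictConfig (fun a : (box 3 m : Set (Site 3)) => x + Torus.proj n (a : Site 3)) ⁻¹' B) =
        μZ.real (restrictConfig (Subtype.val : (box 3 m : Set (Site 3)) → Site 3) ⁻¹' B) := by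
    rw [← map_measureReal_apply (measurable_restrictConfig _) MeasurableSet.of_discrete,
      ← map_measureReal_apply (measurable_restrictConfig _) MeasurableSet.of_discrete,
      hμT, hμZ, map_restrictConfig_chart_eq hn x p]
  -- `ℤ³` side
  have hZ : restrictConfig (Subtype.val : (box 3 m : Set (Site 3)) → Site 3) ⁻¹' B ⊆
      clusterSizeGe (0 : Site 3) (m + 1) :=
    fun ω hω => Necessity.mem_clusterSizeGe_of_succ_le_ncard hω
  calc μT.real {ω | m + 1 ≤ (openCluster ω x).ncard}
      ≤ μT.real ({ω : BondConfig (TorusSite 3 n) | m + 1 ≤ (openCluster ω x).ncard} ∩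
            {ω | ω ⊆ (torusGraph 3 n).edgeSet} ∪
          {ω | ¬ ω ⊆ (torusGraph 3 n).edgeSet}) :=
        measureReal_mono (fun ω hω => by
          by_cases h : ω ⊆ (torusGraph 3 n).edgeSet
          · exact Or.inl ⟨hω, h⟩
          · exact Or.inr h) (measure_ne_top _ _)
    _ ≤ μT.real ({ω : BondConfig (TorusSite 3 n) | m + 1 ≤ (openCluster ω x).ncard} ∩
            {ω | ω ⊆ (torusGraph 3 n).edgeSet}) +
          μT.real {ω | ¬ ω ⊆ (torusGraph 3 n).edgeSet} :=
        measureReal_union_le _ _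
    _ = μT.real ({ω : BondConfig (TorusSite 3 n) | m + 1 ≤ (openCluster ω x).ncard} ∩
            {ω | ω ⊆ (torusGraph 3 n).edgeSet}) := by rw [hnullT, add_zero]
    _ ≤ μT.real (restrictConfig
          (fun a : (box 3 m : Set (Site 3)) => x + Torus.proj n (a : Site 3)) ⁻¹' B) :=
        measureReal_mono hcover (measure_ne_top _ _)
    _ = μZ.real (restrictConfig (Subtype.val : (box 3 m : Set (Site 3)) → Site 3) ⁻¹' B) :=
        htransfer
    _ ≤ μZ.real (clusterSizeGe (0 : Site 3) (m + 1)) := measureReal_mono hZ (measure_ne_top _ _)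

/-- **Necessity of the crux: `θ(p_c) = 0 ⇒ NoCriticalTorusGiant`.** If the percolation
probability of `ℤ³` vanishes at `p_c`, then on the critical torus `T_n` at `p = p_c(ℤ³)`, for
every `ε > 0`, `P(∃ x, |C(x)| ≥ ε n³) → 0`: by the first-moment Markov inequality over the `n³`
vertices (`S1b.natCast_mul_measureReal_le_sum`) with `k = ⌈ε n³⌉ ≥ m + 1` and the finite-range
domination `real_clusterSize_torus_le_zd`, this probability is at most
`ε⁻¹ P_{ℤ³,p_c}(|C(0)| ≥ m + 1)` for all large `n`, and `P_{ℤ³,p_c}(|C(0)| ≥ m + 1) → θ(p_c) = 0`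
(`tendsto_real_clusterSizeGe`). -/
theorem noCriticalTorusGiant_of_theta_eq_zero :
    theta (zdGraph 3) (0 : Site 3) (criticalProbI 3) = 0 →
      Summit.CriticalPhenomena.PercolationContinuityZ3.Theses.PercTorusSliceFilling.NoCriticalTorusGiant := by
  intro hθ ε hε
  -- the claim: for `2m + 2 ≤ n` and `m + 1 ≤ ε n³`, `P(ε-giant) ≤ ε⁻¹ P_{ℤ³}(|C(0)| ≥ m + 1)`
  have hclaim : ∀ m n : ℕ, 2 * m + 2 ≤ n → (m : ℝ) + 1 ≤ ε * (n : ℝ) ^ 3 →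
      (bondPercolation (torusGraph 3 n) (criticalProbI 3)).real
          {ω | ∃ x : TorusSite 3 n, ε * (n : ℝ) ^ 3 ≤ ((openCluster ω x).ncard : ℝ)} ≤
        ε⁻¹ * (bondPercolation (zdGraph 3) (criticalProbI 3)).real
          (clusterSizeGe (0 : Site 3) (m + 1)) := by
    intro m n hn hmn
    haveI : NeZero n := ⟨by omega⟩
    set μT := bondPercolation (torusGraph 3 n) (criticalProbI 3) with hμT
    set θ' := (bondPercolation (zdGraph 3) (criticalProbI 3)).real
      (clusterSizeGe (0 : Site 3) (m + 1)) with hθ'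
    set k := ⌈ε * (n : ℝ) ^ 3⌉₊ with hk
    have hεk : ε * (n : ℝ) ^ 3 ≤ k := Nat.le_ceil _
    have hk1 : m + 1 ≤ k := by
      have h : ((m + 1 : ℕ) : ℝ) ≤ k := le_trans (by push_cast; exact hmn) hεk
      exact_mod_cast h
    have hk0 : 0 < k := lt_of_lt_of_le (Nat.succ_pos m) hk1
    -- `{ε-giant} ⊆ {∃ x, k ≤ |C(x)|}`
    have hsub : {ω : BondConfig (TorusSite 3 n) |
        ∃ x : TorusSite 3 n, ε * (n : ℝ) ^ 3 ≤ ((openCluster ω x).ncard : ℝ)} ⊆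
          {ω | ∃ x : TorusSite 3 n, k ≤ (openCluster ω x).ncard} := by
      rintro ω ⟨x, hx⟩
      exact ⟨x, Nat.ceil_le.2 hx⟩
    -- Markov over vertices
    have hmarkov : (k : ℝ) * μT.real {ω | ∃ x : TorusSite 3 n, k ≤ (openCluster ω x).ncard} ≤
        ∑ x : TorusSite 3 n, μT.real {ω | k ≤ (openCluster ω x).ncard} := by
      refine S1b.natCast_mul_measureReal_le_sum μT
        (fun x => {ω | k ≤ (openCluster ω x).ncard}) _ k
        (fun _ => MeasurableSet.of_discrete) MeasurableSet.of_discrete ?_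
      rintro ω ⟨x₀, hk₀⟩
      refine ⟨(openCluster ω x₀).toFinite.toFinset, ?_, fun y hy => ?_⟩
      · rw [← Set.ncard_eq_toFinset_card _ (openCluster ω x₀).toFinite]
        exact hk₀
      · have hy' : y ∈ openCluster ω x₀ := (Set.Finite.mem_toFinset _).1 hy
        have hC : openCluster ω y = openCluster ω x₀ := (openCluster_eq_of_mem hy').symm
        show k ≤ (openCluster ω y).ncard
        rw [hC]
        exact hk₀
    -- each term is at most `P_{ℤ³}(|C(0)| ≥ m + 1)` (domination)
    have hsum : ∑ x : TorusSite 3 n, μT.real {ω | k ≤ (openCluster ω x).ncard} ≤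
        (n : ℝ) ^ 3 * θ' := by
      calc ∑ x : TorusSite 3 n, μT.real {ω | k ≤ (openCluster ω x).ncard}
          ≤ ∑ _x : TorusSite 3 n, θ' := Finset.sum_le_sum fun x _ =>
            (measureReal_mono (fun ω (hω : k ≤ (openCluster ω x).ncard) => hk1.trans hω)
              (measure_ne_top _ _)).trans (real_clusterSize_torus_le_zd (criticalProbI 3) hn x)
        _ = (n : ℝ) ^ 3 * θ' := by
            rw [Finset.sum_const, Finset.card_univ, nsmul_eq_mul, Fintype.card_fun, ZMod.card,
              Fintype.card_fin, Nat.cast_pow]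
    have h1 : (k : ℝ) * μT.real {ω | ∃ x : TorusSite 3 n, k ≤ (openCluster ω x).ncard} ≤
        (k : ℝ) * (ε⁻¹ * θ') := by
      calc (k : ℝ) * μT.real {ω | ∃ x : TorusSite 3 n, k ≤ (openCluster ω x).ncard}
          ≤ (n : ℝ) ^ 3 * θ' := hmarkov.trans hsum
        _ ≤ (ε⁻¹ * k) * θ' := by
            gcongr
            rw [le_inv_mul_iff₀ hε]
            exact hεk
        _ = (k : ℝ) * (ε⁻¹ * θ') := by ring
    have h2 : μT.real {ω | ∃ x : TorusSite 3 n, k ≤ (openCluster ω x).ncard} ≤ ε⁻¹ * θ' :=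
      le_of_mul_le_mul_left h1 (by exact_mod_cast hk0)
    exact (measureReal_mono hsub (measure_ne_top _ _)).trans h2
  -- `ε⁻¹ P_{ℤ³,p_c}(|C(0)| ≥ M + 1) → ε⁻¹ θ(p_c) = 0`
  have hθM : Tendsto (fun M : ℕ => ε⁻¹ * (bondPercolation (zdGraph 3) (criticalProbI 3)).real
      (clusterSizeGe (0 : Site 3) (M + 1))) atTop (𝓝 0) := by
    have h := ((tendsto_real_clusterSizeGe (zdGraph 3) (0 : Site 3) (criticalProbI 3)).comp
      (tendsto_add_atTop_nat 1)).const_mul ε⁻¹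
    rwa [hθ, mul_zero] at h
  rw [tendsto_order]
  refine ⟨fun a ha => Eventually.of_forall fun n => ha.trans_le measureReal_nonneg,
    fun δ hδ => ?_⟩
  obtain ⟨m, hm⟩ := ((tendsto_order.1 hθM).2 δ hδ).exists
  have hn1 : ∀ᶠ n : ℕ in atTop, 2 * m + 2 ≤ n := eventually_ge_atTop _
  have hn2 : ∀ᶠ n : ℕ in atTop, (m : ℝ) + 1 ≤ ε * (n : ℝ) ^ 3 := by
    have ht : Tendsto (fun n : ℕ => ε * (n : ℝ) ^ 3) atTop atTop :=
      ((tendsto_pow_atTop (by norm_num : (3 : ℕ) ≠ 0)).comp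
        tendsto_natCast_atTop_atTop).const_mul_atTop hε
    exact ht.eventually_ge_atTop _
  filter_upwards [hn1, hn2] with n h1 h2
  exact (hclaim m n h1 h2).trans_lt hm

end Summit.CriticalPhenomena.PercolationContinuityZ3.Theorems.PercTorusSliceFillingNoCriticalTorusGiant
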